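import Summits.ValiantsHypothesis.ValiantsHypothesis.Theorems.SymPencilPerFourHyperplaneFlowOneRow

/-!
# Route `SymPencil` — hyperplane flow rigidity of `per [v; ·]` MODULO the one-row core
# (tool file for the one-row defect-2 cell `(12,4,2)` of `sdc(per_4)`, `--supports`
# stmt-ValiantsHypothesis-5674; nothing here bears on `VP ≠ VNP`)

The glue of val-width-5674-w2 g2's (RIG) line (CELL-TWELVE-FOUR.md §3): (RIG_v) — every exact flow symmetry
`X` of `F_v(y) = per [v; y 0; y 1; y 2]` on a hyperplane `ker ℓ` has a good point `y ∈ ker ℓ`, `X y = 0`,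
`F_v(y) ≠ 0` — follows from

* `ℓ = 0`: `SymPencilPerFourHyperplaneFlow.exists_good_point_of_flow_zero` (landed);
* `ℓ` non-zero on two rows: `…exists_good_point_of_flow_of_two_rows` (landed);
* `ℓ` supported on one row: `…exists_blockDiag_of_flow_one_row` (landed) + the ONE-ROW CORE (stub S1c, the
  R1-CORE of the memo's §2(c)), taken here as the HYPOTHESIS `hcore` in block-diagonal form with the special row
  moved to slot `2` by a row permutation.

* **`exists_good_point_of_flow_of_core`** — `hcore → RIG_v` (all `v_j ≠ 0`, characteristic `0`).

Honest label: CONDITIONAL on `hcore` (= S1c, open, val-width-5674-w2 g2's lane; its per₂ / STAR exceptional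
planes are where the flow is non-trivial but a good point still exists).  A tool toward ONE open cell of the
size-27 table; `27 ≤ sdc(per_4) ≤ 29`, the crux `SdcSuperquadratic` and `VP ≠ VNP` are untouched.
No definitions, no named facts. [folklore]
-/

noncomputable section

-- single-conjunct layout: Sub = Summit, duplicated namespace component intended
set_option linter.dupNamespace false

namespace Summit.ValiantsHypothesis.ValiantsHypothesis.Theorems.SymPencilPerFourHyperplaneFlow

open Matrix
open Summit.ValiantsHypothesis.ValiantsHypothesis.Theorems.SymPencilPerFourInnerRankRows
open Summit.ValiantsHypothesis.ValiantsHypothesis.Theorems.SymPencilPerFourRowForms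

variable {K : Type*} [Field K]

/-- A linear form on `3 × 4` matrices is the sum of its three row components. [folklore] -/
theorem linearForm_rows (ℓ : (Fin 3 → Fin 4 → K) →ₗ[K] K) (y : Fin 3 → Fin 4 → K) :
    ℓ y = ℓ (Pi.single 0 (y 0)) + ℓ (Pi.single 1 (y 1)) + ℓ (Pi.single 2 (y 2)) := by
  conv_lhs => rw [← Finset.univ_sum_single y]
  rw [map_sum, Fin.sum_univ_three]

/-- **(RIG) modulo the one-row core.**  See the module docstring.  `hcore` is the one-row core with the
restricted row in slot `2`: for every non-zero `μ` on `K⁴` and every block-diagonal `(Y₀, Y₁, Y₂)` with the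
exact flow of `F_v` on `K⁴ × K⁴ × ker μ`, some `y` with `μ(y₂) = 0`, `Y_i y_i = 0` and `F_v(y) ≠ 0`. [folklore] -/
theorem exists_good_point_of_flow_of_core [CharZero K] {v : Fin 4 → K} (hv : ∀ j, v j ≠ 0)
    (hcore : ∀ (μ : (Fin 4 → K) →ₗ[K] K) (Y : Fin 3 → (Fin 4 → K) →ₗ[K] (Fin 4 → K)), μ ≠ 0 →
      (∀ y : Fin 3 → Fin 4 → K, μ (y 2) = 0 → ∀ s : K,
        (Matrix.of ![v, y 0 + s • Y 0 (y 0), y 1 + s • Y 1 (y 1), y 2 + s • Y 2 (y 2)]).permanent =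
          (Matrix.of ![v, y 0, y 1, y 2]).permanent) →
      ∃ y : Fin 3 → Fin 4 → K, μ (y 2) = 0 ∧ (∀ i, Y i (y i) = 0) ∧
        (Matrix.of ![v, y 0, y 1, y 2]).permanent ≠ 0)
    (X : (Fin 3 → Fin 4 → K) →ₗ[K] (Fin 3 → Fin 4 → K)) (ℓ : (Fin 3 → Fin 4 → K) →ₗ[K] K)
    (h : ∀ y, ℓ y = 0 → ∀ s : K,
      (Matrix.of ![v, (y + s • X y) 0, (y + s • X y) 1, (y + s • X y) 2]).permanent =
        (Matrix.of ![v, y 0, y 1, y 2]).permanent) :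
    ∃ y, ℓ y = 0 ∧ X y = 0 ∧ (Matrix.of ![v, y 0, y 1, y 2]).permanent ≠ 0 := by
  classical
  -- two rows seen: done
  by_cases htwo : ∃ a b : Fin 3, a ≠ b ∧ (∃ r, ℓ (Pi.single a r) ≠ 0) ∧ (∃ r, ℓ (Pi.single b r) ≠ 0)
  · obtain ⟨a, b, hab, ⟨ra, ha⟩, ⟨rb, hb⟩⟩ := htwo
    exact exists_good_point_of_flow_of_two_rows hv X ℓ a b hab ra rb ha hb h
  push Not at htwo
  by_cases hone : ∃ a r, ℓ (Pi.single a r) ≠ 0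
  · -- exactly one row `a`
    obtain ⟨a, r₀, ha⟩ := hone
    have hrow : ∀ b : Fin 3, b ≠ a → ∀ r : Fin 4 → K, ℓ (Pi.single b r) = 0 := by
      intro b hba r
      by_contra hbr
      exact ha (htwo b a hba ⟨r, hbr⟩ r₀)
    -- move the row `a` to slot `2`
    obtain ⟨π, hπ⟩ : ∃ π : Equiv.Perm (Fin 3), π 2 = a := by
      have h3 : ∀ c : Fin 3, c = 0 ∨ c = 1 ∨ c = 2 := by decide
      rcases h3 a with rfl | rfl | rfl
      exacts [⟨Equiv.swap 0 2, by decide⟩, ⟨Equiv.swap 1 2, by decide⟩, ⟨1, by decide⟩]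
    have hflow := flow_transport v X ℓ π h
    set T : (Fin 3 → Fin 4 → K) →ₗ[K] (Fin 3 → Fin 4 → K) := LinearMap.funLeft K (Fin 4 → K) π.symm with hT
    set Ti : (Fin 3 → Fin 4 → K) →ₗ[K] (Fin 3 → Fin 4 → K) := LinearMap.funLeft K (Fin 4 → K) π with hTi
    have hsingle : ∀ (i : Fin 3) (r : Fin 4 → K), T (Pi.single i r) = Pi.single (π i) r := fun i r => by
      rw [hT, funLeft_symm_single]
    set t : Fin 4 → K := (ℓ (Pi.single a r₀))⁻¹ • r₀ with ht_def
    have ht : (ℓ ∘ₗ T) (Pi.single 2 t) = 1 := by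
      rw [LinearMap.comp_apply, hsingle, hπ, ht_def, Pi.single_smul, map_smul, smul_eq_mul, inv_mul_cancel₀ ha]
    have hrow' : ∀ b : Fin 3, b ≠ 2 → ∀ r : Fin 4 → K, (ℓ ∘ₗ T) (Pi.single b r) = 0 := by
      intro b hb r
      rw [LinearMap.comp_apply, hsingle]
      exact hrow _ (fun e => hb (π.injective (e.trans hπ.symm))) r
    obtain ⟨Y, hXY, hYflow⟩ :=
      exists_blockDiag_of_flow_one_row hv (Ti ∘ₗ X ∘ₗ T) (ℓ ∘ₗ T) 2 t ht hrow' hflow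
    -- the row form `μ`
    let μ : (Fin 4 → K) →ₗ[K] K := (ℓ ∘ₗ T) ∘ₗ LinearMap.single K (fun _ : Fin 3 => Fin 4 → K) 2
    have hμ : ∀ r, μ r = (ℓ ∘ₗ T) (Pi.single 2 r) := fun _ => rfl
    have hμne : μ ≠ 0 := fun h0 => by
      have := LinearMap.congr_fun h0 t
      rw [hμ, ht, LinearMap.zero_apply] at this
      exact one_ne_zero this
    have hker : ∀ y : Fin 3 → Fin 4 → K, (ℓ ∘ₗ T) y = μ (y 2) := by
      intro y
      rw [linearForm_rows (ℓ ∘ₗ T) y, hrow' 0 (by decide), hrow' 1 (by decide), zero_add, zero_add, hμ]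
    obtain ⟨y, hy, hY0, hF⟩ := hcore μ Y hμne (fun y hy s => hYflow y (by rw [hker]; exact hy) s)
    have hy' : (ℓ ∘ₗ T) y = 0 := by rw [hker]; exact hy
    obtain ⟨y', hy'', hXy', hFy'⟩ := exists_good_point_of_blockDiag_good_point (Ti ∘ₗ X ∘ₗ T) (ℓ ∘ₗ T) Y hXY
      ⟨y, hy', hY0, hF⟩
    refine ⟨T y', hy'', ?_, ?_⟩
    · have e : X (T y') = T (Ti (X (T y'))) := by
        funext i
        rw [hT, LinearMap.funLeft_apply, hTi, LinearMap.funLeft_apply, Equiv.apply_symm_apply]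
      rw [e]
      have e2 : Ti (X (T y')) = 0 := hXy'
      rw [e2, map_zero]
    · have e : ∀ i, T y' i = y' (π.symm i) := fun i => rfl
      rw [e, e, e, permanent_rows_perm v y' π.symm]
      exact hFy'
  · -- `ℓ = 0`
    push Not at hone
    have hℓ : ℓ = 0 := by
      refine LinearMap.ext fun y => ?_
      rw [linearForm_rows, hone, hone, hone, add_zero, add_zero, LinearMap.zero_apply]
    subst hℓ
    exact exists_good_point_of_flow_zero hv X h

end Summit.ValiantsHypothesis.ValiantsHypothesis.Theorems.SymPencilPerFourHyperplaneFlow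

end
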